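import Mathlib.CategoryTheory.InducedCategory
import Literature.IUT.LogThetaLattice.StripFrameWitness
import Literature.IUT.LogThetaLattice.BiCoresRealifiedRigidity
import Literature.IUT.HodgeArakelov.RealifiedDFunctor
import Literature.AnabelianGeometry.AbsoluteAnabelian.MonoAnalyticNonarchModel
import HarnessLib

/-!
# [IUTchIII] Thm 1.5 (v) / [IUTchII] Cor 4.10 (v): NON-VACUITY of print's mechanism — a bi-coric datum whose `D^⊩(−)` is
# Cor 4.5 (ii)'s functor into the genuine `ℝ_{>0}`-torsor category of collections of data, source NOT rigid, Thm 1.5 (v) PROVED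

Witness file (abc-iut cell, D-0067 wave 4, seat abc-iut-w4-d005; plan/GAP-LEDGER.md row **G-w4d009-1**, complement (b) of
L6-lead §F v1.18d; small definitions + theorems, nothing landed is re-typed) for the proof-only consumer
`BiCoresRealifiedDFunctor.lean` (same seat): its hypotheses — a FAITHFUL reading `U : B.RFrob ⥤ RlfData V` of the `D^⊩`-data and
a natural isomorphism `η : B.realified ⋙ U ≅ Φ ⋙ realifiedD line c hc` with [IUTchII] Cor 4.5 (ii)'s functor (abc-iut-w4-d009 g2,
`RealifiedDFunctor.lean` p417267 over `RealifiedDataDegreeTorsor.lean` p416964) — are INSTANTIATED over abc-iut-L6-t3's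
witness frame `Witness.twoFrame` (`StripFrameWitness.lean` p408386/p408883: every prime-strip category the one-object
groupoid `Pt` on `ℤˣ = {±1}`, so the `D^⊢`-prime-strip `^{n,m}D^⊢_△ = pt` HAS the non-identity automorphism `negIso = −1`):

* `Witness.RayIdx V` / `rayLines` / `rlfObj` — objects: families `r = (r_v)_v` of nonzero reals, read as the pointed
  real lines `(ℝ, r_v)` = `ℝ_{≥0}(‡D^⊢)_v ∋ log^{‡D^⊢}(p_v)` (abc-iut-L4-t3's `RLine.real`), with `ρ`-scalars `c`; `RlfModel V c hc`
  — the category they induce from the GENUINE torsor category `RlfData V` (Mathlib `InducedCategory`: SAME hom-sets, so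
  `Aut ≅ ℝ_{>0}` — `rlfModel_dilate_ne_id` — NOT the «target rigid» toy `twoBiCoricRigid`), small enough (`Type`,
  `Category.{0}`) to serve as the `RFrob` of a bi-coric datum over `twoFrame`;
* `realModel ℓ : Pt ⥤ RlfModel V c hc` — `D^⊩(−)` := the lift of `realifiedD (fun _ => rayLines ℓ) c hc` (Cor 4.5 (ii)'s
  functor: degree `1`, THE Frobenius-preserving line isomorphisms) through the induced category; `rlfReading` = the fully
  faithful `inducedFunctor` (the `U`), `rlfReadingIso` (the `η`, an identity);
* `rlfBiCoric ℓ : BiCoricData twoFrame` — `Witness.mkBiCoric` with THIS `RFrob`/`realified`, `realifiedHT` constant and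
  `realifiedKummer :=` the FULL poly-isomorphism, which read in `RlfData V` IS the whole `ℝ_{>0}`-orbit of [IUTchII] Cor 4.6 (ii)
  / Cor 4.10 (v) p. 161 (`rlfBiCoric_realifiedKummer_map_eq_orbit`, abc-iut-w4-d009 g2's `RlfData.orbit_eq_full`);
* THEOREMS: `rlfBiCoric_realified_mapIso_negIso` (`D^⊩(−1) = id` although `−1 ≠ id`: `Witness.negIso_ne_refl`),
  `rlfBiCoric_thm15vSingleIso` ([IUTchIII] Thm 1.5 (v) "AN isomorphism" HOLDS for this datum — by abc-iut-w4-d009's criterion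
  `thm15vSingleIso_of_faithful_coordinates` p412780 + `realifiedD_map_endo`, i.e. exactly the route of
  `BiCoricData.thm15vSingleIso_of_realifiedD`), `rlfBiCoric_realifiedRigidAt`.

S. Mochizuki, *Inter-universal Teichmüller theory II*, kurims manuscript (Dec 2020), Cor 4.5 (ii) p. 132, Cor 4.10 (v)
pp. 160–161; *III* (May 2020) Thm 1.5 (v) pp. 50–51. Claim key `Mochizuki2012` DISPUTED (D-0012);
[cite: Mochizuki2012, Cor 4.10 (v) p.160]. HONEST FRAMING: a WITNESS over a toy frame (consistency / non-vacuity of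
interface hypotheses), not an instantiation over real Hodge theaters; nothing here asserts a disputed claim or takes a
side on [IUTchIII] Cor 3.12. No new Prop fact.
-/

namespace Literature.IUT.LogThetaLattice

namespace Witness

open CategoryTheory
open Literature.IUT.HodgeTheaters Literature.IUT.HodgeArakelov Literature.AnabelianGeometry.AbsoluteAnabelian

variable (V : Type) (c : V → ℝ) (hc : ∀ v, 0 < c v)

/-- **IUTchII:Cor4.5(ii)** (kurims p. 132 l. 1–3 "a distinguished element `log^{‡D^⊢}(p_v) ∈ ℝ_{≥0}(‡D^⊢)_v`") the index
of objects of the witness category: a family of NONZERO reals `(r_v)_{v ∈ V}`, the distinguished elements of the lines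
`ℝ_{≥0}(‡D^⊢)_v ⊆ ℝ`. [claim: Mochizuki2012, status: disputed] -/
abbrev RayIdx : Type := V → {r : ℝ // r ≠ 0}

variable {V}

/-- **IUTchII:Cor4.5(ii)** (kurims p. 132) the pointed real lines `(ℝ, r_v)` of an index (abc-iut-L4-t3's `RLine.real`).
[claim: Mochizuki2012, status: disputed] -/
def rayLines (r : RayIdx V) : V → RLine.{0} := fun v => RLine.real (r v).1 (r v).2

variable (V)

/-- **IUTchII:Cor4.5(ii)** (kurims p. 132) the collection of data `(C^⊩, Prime ⥲ V̲, {ρ_v})` of an index: lines `(ℝ, r_v)`,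
`ρ`-scalars `c` (abc-iut-w4-d009 g2's `RlfData`). [claim: Mochizuki2012, status: disputed] -/
def rlfObj (r : RayIdx V) : RlfData.{0, 0} V := ⟨rayLines r, c, hc⟩

/-- **IUTchII:Cor4.10(v)** (kurims p. 160) the witness model of the category of collections of data: the category INDUCED
on the indices from the genuine `ℝ_{>0}`-torsor category `RlfData V` (same hom-sets; `Type`-small with `Category.{0}`, as
`Witness.mkBiCoric` requires of an `RFrob`). [claim: Mochizuki2012, status: disputed] -/
abbrev RlfModel : Type := InducedCategory (RlfData.{0, 0} V) (rlfObj V c hc)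

/-- **IUTchII:Cor4.10(v)** (kurims p. 160) reading the model in `RlfData V`: the (fully faithful) induced functor — the `U`
of `BiCoresRealifiedDFunctor.lean`. [claim: Mochizuki2012, status: disputed] -/
abbrev rlfReading : RlfModel V c hc ⥤ RlfData.{0, 0} V := inducedFunctor (rlfObj V c hc)

/-- **IUTchII:Cor4.10(v)** (kurims p. 161 l. 30–33 "multiplying the arithmetic degrees by a given element `∈ ℝ_{>0}`") the
witness `RFrob` is NOT rigid: the dilation by `2` of any object is a non-identity automorphism (abc-iut-w4-d009 g2's
`RlfData.dilate_ne_id`) — unlike abc-iut-L6-t3's «target rigid» toy `twoBiCoricRigid`. [claim: Mochizuki2012, status: disputed] -/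
theorem rlfModel_dilate_ne_id (X : RlfModel V c hc) :
    InducedCategory.homMk ((rlfObj V c hc X).dilate 2 two_pos) ≠ 𝟙 X := by
  intro h
  exact RlfData.dilate_ne_id (rlfObj V c hc X) two_pos (by norm_num) (congrArg InducedCategory.Hom.hom h)

/-- **IUTchII:Cor4.5(ii)** (kurims p. 132 l. 19–37) `D^⊩(−)` on the witness frame's `D^⊢`-prime-strips `Pt`, valued in the
model: the object `pt ↦ ℓ` (the lines `ℝ_{≥0}(D^⊢)_v` of the one strip) and, on morphisms, abc-iut-w4-d009 g2's `realifiedD`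
(degree `1`, THE Frobenius-preserving line isomorphisms) — lifted through the induced category.
[claim: Mochizuki2012, status: disputed] -/
noncomputable def realModel (ℓ : RayIdx V) : Pt ⥤ RlfModel V c hc where
  obj _ := ℓ
  map f := InducedCategory.homMk ((realifiedD (fun _ : Pt => rayLines ℓ) c hc).map f)
  map_id X := InducedCategory.hom_ext ((realifiedD (fun _ : Pt => rayLines ℓ) c hc).map_id X)
  map_comp f g := InducedCategory.hom_ext ((realifiedD (fun _ : Pt => rayLines ℓ) c hc).map_comp f g)

/-- **IUTchII:Cor4.5(ii)** (kurims p. 132) read in `RlfData V`, the model `D^⊩(−)` IS `realifiedD` — the `η` of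
`BiCoresRealifiedDFunctor.lean` (here an identity). [claim: Mochizuki2012, status: disputed] -/
noncomputable def rlfReadingIso (ℓ : RayIdx V) :
    realModel V c hc ℓ ⋙ rlfReading V c hc ≅ 𝟭 Pt ⋙ realifiedD (fun _ : Pt => rayLines ℓ) c hc :=
  Iso.refl _

/-- **IUTchIII:Thm1.5(iii)–(v)** (kurims pp. 48–51) the WITNESS bi-coric datum over `twoFrame`: abc-iut-L6-t3's `mkBiCoric`
with `RFrob :=` the model of the torsor category, `realified := realModel ℓ` (Cor 4.5 (ii)'s functor), `realifiedHT`
constant at `ℓ`, and `realifiedKummer :=` the FULL poly-isomorphism (= the `ℝ_{>0}`-orbit, below).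
[claim: Mochizuki2012, status: disputed] -/
noncomputable def rlfBiCoric (ℓ : RayIdx V) : BiCoricData twoFrame :=
  mkBiCoric (RlfModel V c hc) (realModel V c hc ℓ) ((Functor.const _).obj ℓ) (fun _ => Iso.refl _)

variable {V c hc}

/-- **IUTchII:Cor4.10(v)** (kurims p. 161 l. 3–9) the Kummer datum of the witness, read in `RlfData V`, IS the whole
`ℝ_{>0}`-orbit of [IUTchII] Cor 4.6 (ii) (abc-iut-w4-d009 g2's `RlfData.orbit`, `orbit_eq_full`) — the orbit clause of
Thm 1.5 (v) is represented, not quotiented. [claim: Mochizuki2012, status: disputed] -/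
theorem rlfBiCoric_realifiedKummer_map_eq_orbit (ℓ : RayIdx V) (X : twoFrame.HT) :
    ((rlfBiCoric V c hc ℓ).realifiedKummer X).map (rlfReading V c hc) = RlfData.orbit (Iso.refl (rlfObj V c hc ℓ)) := by
  rw [RlfData.orbit_eq_full]
  exact PolyIso.map_full_of_fullyFaithful (fullyFaithfulInducedFunctor (rlfObj V c hc)) _ _

/-- **IUTchII:Cor4.10(v)** (kurims p. 160) `D^⊩(−)` of the witness sends EVERY endomorphism of the `D^⊢`-prime-strip to the
identity (abc-iut-w4-d009 g2's `realifiedD_map_endo`, through the induced category). [claim: Mochizuki2012, status: disputed] -/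
theorem rlfBiCoric_realified_map_endo (ℓ : RayIdx V) {X : twoFrame.Dv} (f : X ⟶ X) :
    (rlfBiCoric V c hc ℓ).realified.map f = 𝟙 _ :=
  InducedCategory.hom_ext (realifiedD_map_endo (fun _ : Pt => rayLines ℓ) c hc f)

/-- **IUTchII:Cor4.10(v)** (kurims p. 160) / **IUTchIII:Thm1.5(v)** (p. 50) in particular `D^⊩(−1) = id` for the NON-IDENTITY
automorphism `negIso = −1` of `^{n,m}D^⊢_△ = pt` (`Witness.negIso_ne_refl`): the rigidity comes from the FUNCTOR, the source
and the target both having non-trivial automorphisms. [claim: Mochizuki2012, status: disputed] -/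
theorem rlfBiCoric_realified_mapIso_negIso (ℓ : RayIdx V) :
    (rlfBiCoric V c hc ℓ).realified.mapIso negIso = Iso.refl _ ∧ negIso ≠ Iso.refl pt :=
  ⟨Iso.ext (rlfBiCoric_realified_map_endo ℓ negIso.hom), negIso_ne_refl⟩

/-- **IUTchIII:Thm1.5(v)** (kurims p. 50) "induce … AN isomorphism of collections of data" HOLDS for the witness — by
abc-iut-w4-d009's criterion `thm15vSingleIso_of_faithful_coordinates` (p412780) applied to the faithful reading `rlfReading`,
i.e. the route of `BiCoricData.thm15vSingleIso_of_realifiedD` with `U := rlfReading`, `η := rlfReadingIso`: the hypotheses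
of `BiCoresRealifiedDFunctor.lean` are satisfiable with a NON-rigid source and a NON-rigid target. [claim: Mochizuki2012, status: disputed] -/
theorem rlfBiCoric_thm15vSingleIso (ℓ : RayIdx V) : (rlfBiCoric V c hc ℓ).Thm15vSingleIso :=
  -- the `Faithful` instance is abc-iut-L6-t3's `catRFrob` field read through `mkBiCoric`, so it is passed explicitly
  @BiCoricData.thm15vSingleIso_of_faithful_coordinates _ (rlfBiCoric V c hc ℓ) _ _ (rlfReading V c hc)
    (InducedCategory.faithful (rlfObj V c hc)) fun _ a => by
      rw [rlfBiCoric_realified_map_endo ℓ a.hom]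
      exact (rlfReading V c hc).map_id _

/-- **IUTchII:Cor4.10(v)** (kurims p. 160) abc-iut-L6-t3's consumer hypothesis `RealifiedRigidAt` HOLDS at every pair for the
witness. [claim: Mochizuki2012, status: disputed] -/
theorem rlfBiCoric_realifiedRigidAt (ℓ : RayIdx V) (X Y : twoFrame.Dv) : (rlfBiCoric V c hc ℓ).RealifiedRigidAt X Y :=
  (rlfBiCoric V c hc ℓ).realifiedRigidAt_of_self
    (((rlfBiCoric V c hc ℓ).realifiedRigidAt_self_iff X).mpr fun a =>
      Iso.ext (rlfBiCoric_realified_map_endo ℓ a.hom)) Y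

/-- **IUTchIII:Thm1.5(v)** (kurims p. 50) a CLOSED instance (no parameters left but the index type): all distinguished
elements `1`, all `ρ`-scalars `1` — Thm 1.5 (v) holds for it. [claim: Mochizuki2012, status: disputed] -/
theorem rlfBiCoric_thm15vSingleIso_one :
    (rlfBiCoric V (fun _ => 1) (fun _ => one_pos) fun _ => ⟨1, one_ne_zero⟩).Thm15vSingleIso :=
  rlfBiCoric_thm15vSingleIso _

end Witness

end Literature.IUT.LogThetaLattice
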